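import Literature.AnabelianGeometry.AbsoluteAnabelian.RigidFunctors
import Literature.AlgebraicGeometry.Frobenioids.Categories
import Mathlib.CategoryTheory.Comma.Over.Basic
import HarnessLib

/-!
# Slimness of a category is invariant under equivalence

[FrdI] §0 p. 14 / [GeoAn] Def. 1.2.4: a category `C` is SLIM if every forgetful functor `C_{/A} → C` is
rigid (the tree's `Literature.AlgebraicGeometry.Frobenioids.IsSlim`).  Mathlib-level plumbing for the
abc-iut cell's anabelioid dictionary (campaign-L R1; seat abc-iut-f-072): for LARGE categories
(`C D : Type (u+1)`, morphisms in `Type u` — the shape of `B(G)`, `Action FintypeCat G`, `Cov^fin(X)`; forced by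
the tree's single-universe `AbsoluteAnabelian.IsRigidFunctor` lemmas, slices `Over A` living in `Type (u+1)`)
and an equivalence `e : C ≌ D`:

* `isRigidFunctor_equivalence_functor_comp` — precomposing a rigid functor with an equivalence keeps it
  rigid;
* `isSlim_of_equivalence` / `isSlim_iff_of_equivalence` — `C` is slim iff `D` is
  (`Over.postEquiv`: `C_{/A} ≌ D_{/eA}` over `e`).

Theorems only; nothing here bears on [IUTchIII] Cor. 3.12.
-/

namespace Literature.AnabelianGeometry.AbsoluteAnabelian

open CategoryTheory
open Literature.AlgebraicGeometry.Frobenioids (IsSlim)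

universe u

variable {C D E : Type (u+1)} [LargeCategory C] [LargeCategory D] [LargeCategory E]

/-- **Precomposition with an equivalence preserves rigidity**: if `R : D ⥤ E` is rigid and `P : C ≌ D`,
then `P.functor ⋙ R` is rigid (`P.inverse ⋙ P.functor ⋙ R ≅ R` is rigid and `P.inverse` is essentially
surjective). [cite: MochizukiFrdI2008, §0 p.14] -/
theorem isRigidFunctor_equivalence_functor_comp (P : C ≌ D) {R : D ⥤ E} (hR : IsRigidFunctor R) :
    IsRigidFunctor (P.functor ⋙ R) := by
  have ι : P.inverse ⋙ (P.functor ⋙ R) ≅ R :=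
    (Functor.associator _ _ _).symm ≪≫ Functor.isoWhiskerRight P.counitIso R ≪≫ R.leftUnitor
  exact isRigidFunctor_of_essSurj_precomp (G := P.inverse) (isRigidFunctor_of_iso ι.symm hR)

/-- **Slimness transports along equivalences**: if `D` is slim and `e : C ≌ D` then `C` is slim — the slice
`C_{/A} → C` followed by `e` is `C_{/A} ≌ D_{/eA} → D` (rigid), and `e.functor` is faithful.
[cite: MochizukiFrdI2008, §0 p.14] -/
theorem isSlim_of_equivalence (e : C ≌ D) (hD : IsSlim D) : IsSlim C := by
  refine ⟨fun A => ?_⟩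
  -- the slice over `e A` is rigid over `D`, hence so is `C_{/A} ≌ D_{/eA} → D`
  have h1 : IsRigidFunctor ((Over.postEquiv A e).functor ⋙ Over.forget (e.functor.obj A)) :=
    isRigidFunctor_equivalence_functor_comp (Over.postEquiv A e) (hD.isRigid_forget (e.functor.obj A))
  -- which is `C_{/A} → C → D`
  have h2 : IsRigidFunctor (Over.forget A ⋙ e.functor) :=
    isRigidFunctor_of_iso (NatIso.ofComponents (fun U => Iso.refl _) (fun f => by simp)) h1
  exact isRigidFunctor_of_comp_faithful (G := e.functor) h2

/-- **Slimness is invariant under equivalence of (large) categories.** [cite: MochizukiFrdI2008, §0 p.14] -/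
theorem isSlim_iff_of_equivalence (e : C ≌ D) : IsSlim C ↔ IsSlim D :=
  ⟨fun h => isSlim_of_equivalence e.symm h, fun h => isSlim_of_equivalence e h⟩

end Literature.AnabelianGeometry.AbsoluteAnabelian
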